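import Mathlib
import HarnessLib
import Summits.QuantumAdvantage.QuantumAdvantage.Theses.CodeCarries
import Literature.Computability.Complexity.TimeBoundsProofs
import Literature.Computability.Complexity.BrickAlgebra

/-!
# Line `birth` — BC3 skeleton for the crux `OpiHard` (stmt-QuantumAdvantage-0995)

Route `CodeCarries` (route-QuantumAdvantage-CodeCarries), crux (rank 4, hypothesis-type, refute-only)
`OpiHard := ¬ ∃ A : RandAlg (ℕ × List (List ℕ)) (List ℕ), A.IsPolyTime encI encQ ∧ ∃ P₀, ∀ p F, Valid P₀ p F →
2/3 ≤ A.pr encI (p,F) {cs | Good p F cs}` — NO probabilistic polynomial-time algorithm reaches 7/10 of the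
constraints of every large balanced Optimal-Polynomial-Intersection instance (JSW+ arXiv:2408.08292 §5, Rem 5.2).

Notation (informal; the Lean below is fully unfolded, in the route's own spelling):
`encI (p,F) := boolPair (encodeNat p) (encodingListNatBool.listBool.encode F)`, `encQ := encodingListNatBool.encode`,
`Valid P₀ p F := p.Prime ∧ P₀ ≤ p ∧ |F| = p-1 ∧ ∀ S ∈ F, S.Nodup ∧ |S| = p/2 ∧ ∀ v ∈ S, v < p`,
`Good p F cs := |cs| = (p+9)/10 ∧ (∀ a ∈ cs, a < p) ∧ 7(p-1) ≤ 10·#{j < p-1 : (Σᵢ cs[i](j+1)^i) mod p ∈ F[j]}`,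
`SOLVᴿ := ∃ PPT A, ∃ P₀, ∀ valid (p,F), 2/3 ≤ Pr[A(p,F) Good]` (so `OpiHard = ¬ SOLVᴿ`),
`SOLVᴰ := ∃ f, PolyTimeComputable encI encQ f ∧ ∃ P₀, ∀ valid (p,F), Good p F (f (p,F))` (a DETERMINISTIC solver).

THE LINE — "a uniform randomized lower bound = a deterministic lower bound + derandomisation".
`OpiHard` is a hardness HYPOTHESIS (the route's X-side bet; any proof gives `NP ⊄ BPP`-type separations), so every
honest skeleton is a conditional bridge. This one factors the crux along the only structural seam it has — the
coins — into three registered stubs: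
* `stub_opiDetHard` (`¬ SOLVᴰ`, hypothesis-type, LOAD-BEARING): no DETERMINISTIC polynomial-time function reaches
  7/10 on all large balanced instances — JSW's open challenge in its `FP` form (best known: Prange, 0.55,
  deterministic). It is a CONSEQUENCE of the crux (`opiDetHard_of_opiHard`, proved below: a polynomial-time `f` is
  the coin-free PPT `RandAlg.ofDet f`), strictly weaker in the present state of knowledge, and says nothing about
  randomness.
* `stub_prBPP_subset_prP` (`PromiseBPP' ⊆ PromiseP`, the standard full-derandomisation hypothesis "pr-BPP = pr-P";
  in the tree it FOLLOWS from a `2^{εn}`-average-hard language in `E` by Nisan–Wigderson,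
  `Literature.Computability.Complexity.PromiseBPP'_subset_PromiseP_of_avgHard_E`, and from worst-case hardness via
  Impagliazzo–Wigderson 1997).
* `stub_derandomisedOpiSearch` (`PromiseBPP' ⊆ PromiseP → SOLVᴿ → SOLVᴰ`, PROVABLE NOW, size L): Goldreich's
  "BPP-search problems are solved deterministically in a world of pr-P = pr-BPP" (Goldreich 2011, Thm. 3.5)
  instantiated at OPI — `Good` is decidable in polynomial time (evaluate the polynomial at `p-1 ≤ |x|` points mod `p`),
  so the threshold promise problem "conditional success density of a coin prefix ≥ (t+1)/M vs ≤ t/M" is in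
  `PromiseBPP'`, hence in `PromiseP`, and greedy coin-fixing with the `1/M`-accurate estimates keeps the density
  positive (template, fully proved in the tree for instance-free tests:
  `Literature.Computability.Complexity.DenseSearch.exists_finder_of_PromiseBPP'_subset`; the instance `u = encI x` has
  to be threaded through the test, as `HeavyEnum.exists_enum_of_PromiseBPP'_subset` already does). The coin budget
  `coinLen` need not be computable: try every length `N' ≤ q(|x|)` and keep the first Good output.
* Composition (sorry-free, pure logic): `opiHard_of_stubs` = modus tollens, `SOLVᴿ ⟹ SOLVᴰ ⟹ ⊥`;
  `OpiHard_of : OpiHard` is the crux BY NAME (the only theorem whose head is the crux).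

Disproof used: none exists for this crux (`ledger crux ls stmt-QuantumAdvantage-0995`: no workfiles, no Negative
lemmas; `ledger negatives --problem QuantumAdvantage`: 6 entries, none about OPI / derandomisation).
`sorry` occurs ONLY in the three `stub_*` theorems.
-/

-- `Summit.<Summit>.<Problem>`: for the single-conjunct summit the duplicate `QuantumAdvantage.QuantumAdvantage` is mandated.
set_option linter.dupNamespace false
set_option linter.unusedVariables false

namespace Summit.QuantumAdvantage.QuantumAdvantage.Cruxes.OpiHard.Birth

open Summit.QuantumAdvantage.QuantumAdvantage.Theses.CodeCarries
open Literature.Computability.Complexity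

/-! ## The three registered stubs (statements fully unfolded; registered verbatim) -/

/-- **Stub 1 — deterministic OPI hardness** (`¬ SOLVᴰ`; hypothesis-type, LOAD-BEARING). No polynomial-time
computable `f : (p, F) ↦ cs` (w.r.t. the route's encoders `encI`, `encQ`) outputs, for some `P₀` and every valid
balanced instance with `p ≥ P₀`, a Good coefficient list (≥ 7/10 of the `p-1` constraints). Why plausibly true:
the best deterministic (indeed the best classical) polynomial-time algorithm known is Prange's — interpolate
`n = ⌈p/10⌉` constraints exactly, 1/2 of the rest by balance — reaching `1/2 + n/(2p) = 0.55 < 0.70`; lattice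
(Bleichenbacher–Nguyen 2000) and list-decoding (Guruswami–Sudan) attacks are ineffective at `|F_y| = p/2`,
`n/m = 1/10` (JSW+ §11); it is implied by the crux (`opiDetHard_of_opiHard` below). Why it might fail: a
deterministic 0.70-algorithm exploiting Reed–Solomon structure (JSW's open challenge, Rem 5.2). Size: — (it is a
lower bound of `P ≠ NP` strength; refute-only, like the crux). Sources: arXiv:2408.08292 Rem 5.2 + §11;
arXiv:2607.28120 §V; arXiv:2603.04540. -/
theorem stub_opiDetHard :
    ¬ ∃ f : ℕ × List (List ℕ) → List ℕ,
      Literature.Computability.Complexity.PolyTimeComputable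
          (fun I : ℕ × List (List ℕ) => Literature.Computability.Complexity.boolPair
            (Computability.encodeNat I.1)
            (Literature.Computability.Complexity.encodingListNatBool.listBool.encode I.2))
          Literature.Computability.Complexity.encodingListNatBool.encode f ∧
        ∃ P₀ : ℕ, ∀ (p : ℕ) (F : List (List ℕ)),
          (p.Prime ∧ P₀ ≤ p ∧ F.length = p - 1 ∧ ∀ S ∈ F, S.Nodup ∧ S.length = p / 2 ∧ ∀ v ∈ S, v < p) →
            f (p, F) ∈ {cs : List ℕ | cs.length = (p + 9) / 10 ∧ (∀ a ∈ cs, a < p) ∧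
              7 * (p - 1) ≤ 10 * ((List.range (p - 1)).filter (fun j =>
                decide ((((List.range cs.length).map (fun i => cs.getD i 0 * (j + 1) ^ i)).sum % p) ∈
                  F.getD j []))).length} := by
  sorry

/-- **Stub 2 — full derandomisation of promise-BPP** (`pr-BPP = pr-P` as the inclusion of the tree's promise
classes; hypothesis-type, STANDARD). Why plausibly true: it follows from circuit lower bounds for `E`
(Impagliazzo–Wigderson 1997; Nisan–Wigderson 1994 in the average-case form, PROVED in the tree as
`PromiseBPP'_subset_PromiseP_of_avgHard_E`), and is the working hypothesis of Goldreich 2011. Why it might fail: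
only if `E ⊆ SIZE(2^{o(n)})`-type collapses hold; no evidence. Size: — (conjecture). Sources: Goldreich 2011
(LNCS 6650) §3; ImpagliazzoWigderson1997; NisanWigderson1994 Thm 3; Goldreich2006 §1.2. -/
theorem stub_prBPP_subset_prP :
    Literature.Computability.Complexity.PromiseBPP' ⊆ Literature.Computability.Complexity.PromiseP := by
  sorry

/-- **Stub 3 — derandomised OPI search** (Goldreich 2011, Thm. 3.5 at OPI; PROVABLE NOW, size L). Under
`PromiseBPP' ⊆ PromiseP`, a PPT algorithm that outputs a Good list with probability `≥ 2/3` on every large valid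
instance yields a deterministic polynomial-time function doing so on every large valid instance: `Good` is
polynomial-time decidable from `(encI x, encQ cs)`, so for each candidate coin length `N' ≤ q(|x|)` the promise
problem "the conditional success density of coin prefix `π` is `≥ (t+1)/M`" vs "`≤ t/M`" is in `PromiseBPP'`
(sample suffixes, Hoeffding), hence has a separator in `P`; greedy prefix extension with the resulting
`1/M`-accurate estimates loses `≤ 2/M` density per step (method of conditional probabilities), so from density
`≥ 2/3` at the true `N' = coinLen |x|` it reaches a coin string `r*` with `A.run x r*` Good; output the first Good
candidate over `N'`. Polynomial time by `PolyTimeComputable.comp_holds` and the `FP` bricks. Leans on: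
`DenseSearch.exists_finder_of_PromiseBPP'_subset` (template: instance-free test), `HeavyEnum.*` (instance
threading), `BPPAmp.*` (sampling), `comp_mem_FP`, `fstF/sndF`. Sources: Goldreich 2011 §3 Thm 3.5;
AroraBarak2009 §7.4.1. -/
theorem stub_derandomisedOpiSearch :
    Literature.Computability.Complexity.PromiseBPP' ⊆ Literature.Computability.Complexity.PromiseP →
    (∃ A : Literature.Computability.Complexity.RandAlg (ℕ × List (List ℕ)) (List ℕ),
      A.IsPolyTime
          (fun I : ℕ × List (List ℕ) => Literature.Computability.Complexity.boolPair
            (Computability.encodeNat I.1)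
            (Literature.Computability.Complexity.encodingListNatBool.listBool.encode I.2))
          Literature.Computability.Complexity.encodingListNatBool.encode ∧
        ∃ P₀ : ℕ, ∀ (p : ℕ) (F : List (List ℕ)),
          (p.Prime ∧ P₀ ≤ p ∧ F.length = p - 1 ∧ ∀ S ∈ F, S.Nodup ∧ S.length = p / 2 ∧ ∀ v ∈ S, v < p) →
            (2 : ℝ) / 3 ≤ A.pr
              (fun I : ℕ × List (List ℕ) => Literature.Computability.Complexity.boolPair
                (Computability.encodeNat I.1)
                (Literature.Computability.Complexity.encodingListNatBool.listBool.encode I.2))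
              (p, F)
              {cs : List ℕ | cs.length = (p + 9) / 10 ∧ (∀ a ∈ cs, a < p) ∧
                7 * (p - 1) ≤ 10 * ((List.range (p - 1)).filter (fun j =>
                  decide ((((List.range cs.length).map (fun i => cs.getD i 0 * (j + 1) ^ i)).sum % p) ∈
                    F.getD j []))).length}) →
    ∃ f : ℕ × List (List ℕ) → List ℕ,
      Literature.Computability.Complexity.PolyTimeComputable
          (fun I : ℕ × List (List ℕ) => Literature.Computability.Complexity.boolPair
            (Computability.encodeNat I.1)
            (Literature.Computability.Complexity.encodingListNatBool.listBool.encode I.2))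
          Literature.Computability.Complexity.encodingListNatBool.encode f ∧
        ∃ P₀ : ℕ, ∀ (p : ℕ) (F : List (List ℕ)),
          (p.Prime ∧ P₀ ≤ p ∧ F.length = p - 1 ∧ ∀ S ∈ F, S.Nodup ∧ S.length = p / 2 ∧ ∀ v ∈ S, v < p) →
            f (p, F) ∈ {cs : List ℕ | cs.length = (p + 9) / 10 ∧ (∀ a ∈ cs, a < p) ∧
              7 * (p - 1) ≤ 10 * ((List.range (p - 1)).filter (fun j =>
                decide ((((List.range cs.length).map (fun i => cs.getD i 0 * (j + 1) ^ i)).sum % p) ∈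
                  F.getD j []))).length} := by
  sorry

/-! ## Sorry-free infrastructure: a deterministic polynomial-time solver is a PPT solver
(so Stub 1 is a CONSEQUENCE of the crux — the factorisation `OpiHard ⟺ ¬SOLVᴰ ∧ (SOLVᴿ → SOLVᴰ)`) -/

/-- Transport of polynomial time along encoders: if the encoded graph of `g` is an `FP` string function `φ`
(`eb (g a) = φ (ea a)`), then `g` is `PolyTimeComputable ea eb` — by the very same machine. [folklore] -/
theorem polyTimeComputable_of_mem_FP {α β : Type} {ea : α → List Bool} {eb : β → List Bool}
    {g : α → β} {φ : List Bool → List Bool} (hφ : φ ∈ FP) (h : ∀ a, eb (g a) = φ (ea a)) :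
    PolyTimeComputable ea eb g := by
  have hφ' : PolyTimeComputable id id φ := hφ
  obtain ⟨q, M, hM⟩ := hφ'
  refine ⟨q, M, fun a => ?_⟩
  have hMa := hM (ea a)
  simpa [h a] using hMa

/-- Reading the input off the `boolPair`-encoded pair (input, coins) is polynomial time (`fstF ∈ FP`).
[Arora–Barak 2009, Claim 2.4] -/
theorem polyTimeComputable_fst_boolPair {α : Type} (ea : α → List Bool) :
    PolyTimeComputable (fun q : α × List Bool => boolPair (ea q.1) q.2) ea (Prod.fst : α × List Bool → α) :=
  polyTimeComputable_of_mem_FP Brick.fstF_mem_FP fun q => (Brick.fstF_boolPair (ea q.1) q.2).symm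

/-- A polynomial-time computable function, run as the coin-free randomized algorithm `RandAlg.ofDet f`, is PPT
(Boolean-encoder instance of the tree's named fact `RandAlg.IsPolyTime.ofDet`, discharged here with
`PolyTimeComputable.comp_holds` and `fstF`). [Arora–Barak 2009, §7.1 (`P ⊆ BPP`)] -/
theorem isPolyTime_ofDet {α β : Type} {ea : α → List Bool} {eb : β → List Bool} {f : α → β}
    (hf : PolyTimeComputable ea eb f) : (RandAlg.ofDet f).IsPolyTime ea eb := by
  refine ⟨?_, 0, fun n => Nat.zero_le _⟩
  have h := PolyTimeComputable.comp_holds hf (polyTimeComputable_fst_boolPair ea)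
  exact h

/-- **Stub 1 is implied by the crux**: a deterministic polynomial-time 0.70-solver is a PPT 0.70-solver with
success probability `1 ≥ 2/3` (`RandAlg.pr_ofDet`). Hence the skeleton FACTORS the crux:
`OpiHard ⟺ stub_opiDetHard ∧ (SOLVᴿ → SOLVᴰ)`, the second factor being supplied by Stubs 2+3. [folklore] -/
theorem opiDetHard_of_opiHard (hH : OpiHard) :
    ¬ ∃ f : ℕ × List (List ℕ) → List ℕ,
      Literature.Computability.Complexity.PolyTimeComputable
          (fun I : ℕ × List (List ℕ) => Literature.Computability.Complexity.boolPair
            (Computability.encodeNat I.1)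
            (Literature.Computability.Complexity.encodingListNatBool.listBool.encode I.2))
          Literature.Computability.Complexity.encodingListNatBool.encode f ∧
        ∃ P₀ : ℕ, ∀ (p : ℕ) (F : List (List ℕ)),
          (p.Prime ∧ P₀ ≤ p ∧ F.length = p - 1 ∧ ∀ S ∈ F, S.Nodup ∧ S.length = p / 2 ∧ ∀ v ∈ S, v < p) →
            f (p, F) ∈ {cs : List ℕ | cs.length = (p + 9) / 10 ∧ (∀ a ∈ cs, a < p) ∧
              7 * (p - 1) ≤ 10 * ((List.range (p - 1)).filter (fun j =>
                decide ((((List.range cs.length).map (fun i => cs.getD i 0 * (j + 1) ^ i)).sum % p) ∈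
                  F.getD j []))).length} := by
  rintro ⟨f, hf, P₀, hP⟩
  apply hH
  refine ⟨RandAlg.ofDet f, isPolyTime_ofDet hf, P₀, fun p F hv => ?_⟩
  classical
  rw [RandAlg.pr_ofDet, if_pos (hP p F hv)]
  norm_num

/-! ## The composition: stub signatures ⟹ the crux (sorry-free, pure logic) -/

/-- **The real composition** (modus tollens). From the three stub statements, taken as hypotheses verbatim:
a PPT 0.70-solver (`SOLVᴿ`) would, by Stub 3 under Stub 2, give a deterministic polynomial-time 0.70-solver
(`SOLVᴰ`), contradicting Stub 1. The conclusion is deliberately the UNFOLDED crux so that `OpiHard_of` below is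
the only theorem whose head is the crux decl. [folklore] -/
theorem opiHard_of_stubs
    (hdet : ¬ ∃ f : ℕ × List (List ℕ) → List ℕ,
      Literature.Computability.Complexity.PolyTimeComputable
          (fun I : ℕ × List (List ℕ) => Literature.Computability.Complexity.boolPair
            (Computability.encodeNat I.1)
            (Literature.Computability.Complexity.encodingListNatBool.listBool.encode I.2))
          Literature.Computability.Complexity.encodingListNatBool.encode f ∧
        ∃ P₀ : ℕ, ∀ (p : ℕ) (F : List (List ℕ)),
          (p.Prime ∧ P₀ ≤ p ∧ F.length = p - 1 ∧ ∀ S ∈ F, S.Nodup ∧ S.length = p / 2 ∧ ∀ v ∈ S, v < p) →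
            f (p, F) ∈ {cs : List ℕ | cs.length = (p + 9) / 10 ∧ (∀ a ∈ cs, a < p) ∧
              7 * (p - 1) ≤ 10 * ((List.range (p - 1)).filter (fun j =>
                decide ((((List.range cs.length).map (fun i => cs.getD i 0 * (j + 1) ^ i)).sum % p) ∈
                  F.getD j []))).length})
    (hder : Literature.Computability.Complexity.PromiseBPP' ⊆ Literature.Computability.Complexity.PromiseP)
    (hsearch :
      Literature.Computability.Complexity.PromiseBPP' ⊆ Literature.Computability.Complexity.PromiseP →
      (∃ A : Literature.Computability.Complexity.RandAlg (ℕ × List (List ℕ)) (List ℕ),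
        A.IsPolyTime
            (fun I : ℕ × List (List ℕ) => Literature.Computability.Complexity.boolPair
              (Computability.encodeNat I.1)
              (Literature.Computability.Complexity.encodingListNatBool.listBool.encode I.2))
            Literature.Computability.Complexity.encodingListNatBool.encode ∧
          ∃ P₀ : ℕ, ∀ (p : ℕ) (F : List (List ℕ)),
            (p.Prime ∧ P₀ ≤ p ∧ F.length = p - 1 ∧ ∀ S ∈ F, S.Nodup ∧ S.length = p / 2 ∧ ∀ v ∈ S, v < p) →
              (2 : ℝ) / 3 ≤ A.pr
                (fun I : ℕ × List (List ℕ) => Literature.Computability.Complexity.boolPair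
                  (Computability.encodeNat I.1)
                  (Literature.Computability.Complexity.encodingListNatBool.listBool.encode I.2))
                (p, F)
                {cs : List ℕ | cs.length = (p + 9) / 10 ∧ (∀ a ∈ cs, a < p) ∧
                  7 * (p - 1) ≤ 10 * ((List.range (p - 1)).filter (fun j =>
                    decide ((((List.range cs.length).map (fun i => cs.getD i 0 * (j + 1) ^ i)).sum % p) ∈
                      F.getD j []))).length}) →
      ∃ f : ℕ × List (List ℕ) → List ℕ,
        Literature.Computability.Complexity.PolyTimeComputable
            (fun I : ℕ × List (List ℕ) => Literature.Computability.Complexity.boolPair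
              (Computability.encodeNat I.1)
              (Literature.Computability.Complexity.encodingListNatBool.listBool.encode I.2))
            Literature.Computability.Complexity.encodingListNatBool.encode f ∧
          ∃ P₀ : ℕ, ∀ (p : ℕ) (F : List (List ℕ)),
            (p.Prime ∧ P₀ ≤ p ∧ F.length = p - 1 ∧ ∀ S ∈ F, S.Nodup ∧ S.length = p / 2 ∧ ∀ v ∈ S, v < p) →
              f (p, F) ∈ {cs : List ℕ | cs.length = (p + 9) / 10 ∧ (∀ a ∈ cs, a < p) ∧
                7 * (p - 1) ≤ 10 * ((List.range (p - 1)).filter (fun j =>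
                  decide ((((List.range cs.length).map (fun i => cs.getD i 0 * (j + 1) ^ i)).sum % p) ∈
                    F.getD j []))).length}) :
    ¬ ∃ A : Literature.Computability.Complexity.RandAlg (ℕ × List (List ℕ)) (List ℕ),
      A.IsPolyTime
          (fun I : ℕ × List (List ℕ) => Literature.Computability.Complexity.boolPair
            (Computability.encodeNat I.1)
            (Literature.Computability.Complexity.encodingListNatBool.listBool.encode I.2))
          Literature.Computability.Complexity.encodingListNatBool.encode ∧
        ∃ P₀ : ℕ, ∀ (p : ℕ) (F : List (List ℕ)),
          (p.Prime ∧ P₀ ≤ p ∧ F.length = p - 1 ∧ ∀ S ∈ F, S.Nodup ∧ S.length = p / 2 ∧ ∀ v ∈ S, v < p) →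
            (2 : ℝ) / 3 ≤ A.pr
              (fun I : ℕ × List (List ℕ) => Literature.Computability.Complexity.boolPair
                (Computability.encodeNat I.1)
                (Literature.Computability.Complexity.encodingListNatBool.listBool.encode I.2))
              (p, F)
              {cs : List ℕ | cs.length = (p + 9) / 10 ∧ (∀ a ∈ cs, a < p) ∧
                7 * (p - 1) ≤ 10 * ((List.range (p - 1)).filter (fun j =>
                  decide ((((List.range cs.length).map (fun i => cs.getD i 0 * (j + 1) ^ i)).sum % p) ∈
                    F.getD j []))).length} :=
  fun hX => hdet (hsearch hder hX)

/-- **THE skeleton theorem** — the crux `OpiHard` BY NAME from the three declared stubs via the sorry-free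
composition `opiHard_of_stubs` (`ledger skeleton check` shape: no hypotheses; `sorry` enters only through
`stub_opiDetHard`, `stub_prBPP_subset_prP`, `stub_derandomisedOpiSearch`). [folklore] -/
theorem OpiHard_of : OpiHard :=
  opiHard_of_stubs stub_opiDetHard stub_prBPP_subset_prP stub_derandomisedOpiSearch

end Summit.QuantumAdvantage.QuantumAdvantage.Cruxes.OpiHard.Birth
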